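import Summits.QuantumFields.YangMills.Theorems.BalabanUVNodesN27AtKernelPinnedReading13CoPH
import Summits.QuantumFields.YangMills.Theorems.BalabanUVNodesN22AtU3OfKernels
import Summits.QuantumFields.YangMills.Theorems.BalabanUVNodesN18AtU3OfKernels

/-!
# BalabanUVNodes ∕ N27 = binder B5 AT THE RECORD — module (Kᴾ): THE K3⁷ REDUCTION AT A KERNEL-PINNED STAGE-13 RATE READING WITH **EVERY U3-KEYED SLOT IN ITS PRODUCER's
# LANDED KERNEL CURRENCY** — N22 ⟸ dag-n22-w3's (1.21) PASSAGE `YMDAG.N22.AtKernels.n22At_u3OfRecord₁₃_objectsOfRecord₁₃_of_windowed` (p593053: windowed finite-volume joint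
# history-Lipschitz bounds of the merged term family of record + def-B's `PolLimitExists`), N18 ⟸ dag-n18-w1's FAMILY REDUCTION
# `YMDAG.N18.AtU3OfKernels.n18At_u3OfRecord₁₃_objectsOfRecord₁₃_of_n22At_of_member` (p593165: N22 + `ω ≤ θ₅` + NE5 at ONE member `b₀ ∈ ]0, θ.γ]` with constant
# `C₅ − C₉·θ.γ`), (D4) ⟸ print's (5.10) `KernelDecayOfRecord₁₃` (this seat's g0 p591653), N17 ELIMINATED; N14 ∕ N15 generic, N16 IN THE CURRENCY OF RECORD «R-β»; over module (K)
# `…N27AtKernelPinnedReading13CoPH` §2 `spine_rec13CCoPHOn_holder_of_kernels_pin` BY NAME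
# (cell `pub-ymgap`, HUMAN RULING D-0062 Track A; director-ym №197 ∕ HUMAN RULING D-0149; width seat `pub-ymgap-dag-n27-w1` gen 2 on NODE n27 (B5 composite); K3⁷
# `SpineGivenEndpointR13SepCoPH` = stmt-QuantumFields-20544, `--kind proof --supports 20544 --as helper`; COUNT-NEUTRAL; THEOREMS ONLY, 0 `def`, 0 `sorry`; `N`-generic,
# regime-generic, NO Theses import — the item-facing face is leaf (Kᴾ′) `…N27SpineGivenEndpointR13SepCoPHKernelsProducers`)

WHAT IS KERNEL-CHECKED ([bookkeeping]).
* §1 the two producer faces in guarded θ-form at the kernel bundle of record: `n22At_kernels_of_windowed_guarded` (N22 at every guarded tuple and run length from the letter signs, the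
  existence of the (1.21) limits of record on the window and the windowed NE9 bounds of record) · `n18At_kernels_of_windowed_member_guarded` (N18 from the same + `ω ≤ θ₅` + one
  NE5 member per run length).
* §2 ★★ `spine_rec13CCoPHOn_holder_of_kernels_pin_of_windowed_member` — N27 = B5 at node00-def-RR-2's regime record class from: the pin; N14 ∕ N15 ∕ N16-at-β stubs at the
  regime home of `𝔯`; per guarded tuple the letter inequalities `(ℓ F θ).Signs`, `0 < κ`, `betaPrime510 4 1 κ ≤ cr`, `ω ≤ θ₅`; `PolLimitExists` of the merged term family of record on
  the window; the windowed NE9 bounds; one NE5 member per run length; the (5.10) clause; K5's `h20 h21`, `hx`, the N19′ edge `h19` at exponent β.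

HONEST FRAMING.  COMPOSITE-node bookkeeping BY NAME; a REDUCTION, not a discharge: every U3 slot of K4 now reads DISPLAYED finite-volume ∕ limiting-kernel letters — the windowed
joint history-Lipschitz bounds (= NE9 AT FINITE VOLUME, NOT PRINTED for d = 4), the existence of the (1.21) limits (def-B's `PolLimitExists`, [Balaban1987RG1] p. 264 «this limit
exists by (1.7)» — NOT proved), NE5 at one member of run B's family (NOT PRINTED as such), (5.10) for the limiting kernels (print's claim p. 293, NOT proved); NE1′, NE2, NE3 at
exponent β, NE7-cluster, the K5 stubs, the N19′ edge are hypotheses inhabited for no family today (K0⁷ OPEN); β a LETTER; nothing of Bałaban's asserted or instantiated; no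
`Provisos₁₃CoPH` inhabitant claimed; N17 ∕ N18 ∕ N22 ∕ N27 NOT discharged; K3⁷ OPEN, NOT claimed; skeleton v2 145a664ea9c38a7b and every landed decl UNTOUCHED (additive file); counts
UNMOVED (typed 28∕28 · discharged 5∕27, A 5∕28); one finite four-torus programme at fixed `ε` — R4 closes the conditional rung `BalabanLadder.UV` only: NOT ℝ⁴, NOT infinite volume,
NOT OS, NOT a mass gap, NOT Clay.  No decl below carries a cite tag.
-/

set_option autoImplicit false

namespace Summit.QuantumFields.YangMills.Theorems.BalabanUVNodesN27SpineRecord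

open Filter
open scoped Matrix.Norms.L2Operator
open Literature.MathematicalPhysics.QuantumFieldTheory.Balaban1983to89
open Literature.MathematicalPhysics.QuantumFieldTheory.Balaban1983to89.T4Continuum
open Literature.MathematicalPhysics.QuantumFieldTheory.Balaban1983to89.T4OutputRate (Window NE5)
open Literature.MathematicalPhysics.QuantumFieldTheory.Balaban1983to89.B12Sec2to5 (betaPrime510 l1)
open Literature.MathematicalPhysics.QuantumFieldTheory.Balaban1983to89.Node00 (polWindow PolLimitExists mergedTermFamilyMatT TβOfRecord₁₃ chiβOfRecord₁₃)
open Literature.MathematicalPhysics.QuantumFieldTheory.Balaban1983to89.Node00.U3OfKernels (histPrefix objectsOfRecord₁₃ KernelDecayOfRecord₁₃)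
open T4ContinuumYM4Torus (ForSmallCouplings)
open Summit.QuantumFields.BalabanUV.T4Continuum.Spine
open YMDAG.UVSplit
open Node00 (Stage13HParams datumOfRecord₁₃CoPH U3Letters₁₁)
open Summit.QuantumFields.YangMills.BalabanUVNodes.N16HolderDefs (S_N16Holder)
open Summit.QuantumFields.YangMills.BalabanUVNodes.SpineRatesHolder (RatesHolderAt)
open YMDAG.N22.AtKernels (n22At_u3OfRecord₁₃_objectsOfRecord₁₃_of_windowed)
open YMDAG.N18.AtU3OfKernels (n18At_u3OfRecord₁₃_objectsOfRecord₁₃_of_n22At_of_member)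

variable {N : ℕ} [NeZero N] (cr : SpineReading₁₃CoPH N) (β : ℝ) (𝔯 : RateReading₁₃CoPH N) (Rg : (F : T4Family) → Stage13HParams F N → Prop)
  (ℓ : (F : T4Family) → Stage13HParams F N → U3Letters₁₁)

/-! ## §1 The N22 and N18 producer faces in guarded θ-form at the kernel bundle of record -/

/-- **N22 AT THE KERNEL BUNDLE OF RECORD, EVERY GUARDED TUPLE AND RUN LENGTH, FROM THE WINDOWED INPUTS** (dag-n22-w3 `n22At_u3OfRecord₁₃_objectsOfRecord₁₃_of_windowed` per
tuple): letter signs, `PolLimitExists` of the merged term family of record at every history of the window and every level, the windowed joint history-Lipschitz bounds with the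
moduli of record `(ℓ F θ).moduli`, eventually in `K`.  LOCATED; N22 NOT discharged. [bookkeeping] -/
theorem n22At_kernels_of_windowed_guarded
    (hs : ∀ (F : T4Family) (θ : Stage13HParams F N), θ.Provisos₁₃CoPH F N → Rg F θ → θ.Admissible F N → (ℓ F θ).Signs)
    (hlim : ∀ (F : T4Family) (θ : Stage13HParams F N), θ.Provisos₁₃CoPH F N → Rg F θ → θ.Admissible F N →
      letI := θ.instVβ₁; letI := θ.instVβ₂; letI := θ.instιβ
      ∀ g ∈ Window θ.γ, ∀ j : ℕ,
        PolLimitExists F (j + 1)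
          (fun K => mergedTermFamilyMatT F N (TβOfRecord₁₃ F N) (chiβOfRecord₁₃ F N θ.toStage13Params) θ.εbg j (histPrefix g j) K) θ.ρ8 θ.bV)
    (hK : ∀ (F : T4Family) (θ : Stage13HParams F N), θ.Provisos₁₃CoPH F N → Rg F θ → θ.Admissible F N →
      letI := θ.instVβ₁; letI := θ.instVβ₂; letI := θ.instιβ
      ∀ g ∈ Window θ.γ, ∀ g' ∈ Window θ.γ, ∀ (j : ℕ) (μ ν : Fin 4) (z : Fin 4 → ℤ), ∀ᶠ K in atTop,
        |polWindow F K (j + 1)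
              (mergedTermFamilyMatT F N (TβOfRecord₁₃ F N) (chiβOfRecord₁₃ F N θ.toStage13Params) θ.εbg j (histPrefix g j) K) θ.ρ8 θ.bV μ ν z -
            polWindow F K (j + 1)
              (mergedTermFamilyMatT F N (TβOfRecord₁₃ F N) (chiβOfRecord₁₃ F N θ.toStage13Params) θ.εbg j (histPrefix g' j) K) θ.ρ8 θ.bV μ ν z| ≤
          Real.exp (-((ℓ F θ).κ * l1 z)) * ∑ i ∈ Finset.range (j + 1), (ℓ F θ).moduli (j + 1) i * |g i - g' i|) :
    ∀ (F : T4Family) (θ : Stage13HParams F N), θ.Provisos₁₃CoPH F N → Rg F θ → θ.Admissible F N → ∀ k : ℕ,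
      N22At (u3OfRecord₁₃ θ.toStage13Params (objectsOfRecord₁₃ F N θ.toStage13Params (ℓ F θ)) k) :=
  fun F θ hP hRg hθ k =>
    n22At_u3OfRecord₁₃_objectsOfRecord₁₃_of_windowed F N θ.toStage13Params (ℓ F θ) (hs F θ hP hRg hθ) k (hlim F θ hP hRg hθ) (hK F θ hP hRg hθ)

/-- **N18 AT THE KERNEL BUNDLE OF RECORD, EVERY GUARDED TUPLE AND RUN LENGTH, FROM THE WINDOWED INPUTS AND ONE NE5 MEMBER** (dag-n18-w1
`n18At_u3OfRecord₁₃_objectsOfRecord₁₃_of_n22At_of_member` over §1's N22 face): additionally `(ℓ F θ).ω ≤ (ℓ F θ).θ₅` and, per run length `k`, NE5 at ONE member `b₀ ∈ ]0, θ.γ]` of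
run B's family with constant `(ℓ F θ).C₅ − (ℓ F θ).C₉·θ.γ`.  LOCATED; N18 NOT discharged. [bookkeeping] -/
theorem n18At_kernels_of_windowed_member_guarded
    (hs : ∀ (F : T4Family) (θ : Stage13HParams F N), θ.Provisos₁₃CoPH F N → Rg F θ → θ.Admissible F N → (ℓ F θ).Signs)
    (hωθ : ∀ (F : T4Family) (θ : Stage13HParams F N), θ.Provisos₁₃CoPH F N → Rg F θ → θ.Admissible F N → (ℓ F θ).ω ≤ (ℓ F θ).θ₅)
    (hlim : ∀ (F : T4Family) (θ : Stage13HParams F N), θ.Provisos₁₃CoPH F N → Rg F θ → θ.Admissible F N →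
      letI := θ.instVβ₁; letI := θ.instVβ₂; letI := θ.instιβ
      ∀ g ∈ Window θ.γ, ∀ j : ℕ,
        PolLimitExists F (j + 1)
          (fun K => mergedTermFamilyMatT F N (TβOfRecord₁₃ F N) (chiβOfRecord₁₃ F N θ.toStage13Params) θ.εbg j (histPrefix g j) K) θ.ρ8 θ.bV)
    (hK : ∀ (F : T4Family) (θ : Stage13HParams F N), θ.Provisos₁₃CoPH F N → Rg F θ → θ.Admissible F N →
      letI := θ.instVβ₁; letI := θ.instVβ₂; letI := θ.instιβ
      ∀ g ∈ Window θ.γ, ∀ g' ∈ Window θ.γ, ∀ (j : ℕ) (μ ν : Fin 4) (z : Fin 4 → ℤ), ∀ᶠ K in atTop,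
        |polWindow F K (j + 1)
              (mergedTermFamilyMatT F N (TβOfRecord₁₃ F N) (chiβOfRecord₁₃ F N θ.toStage13Params) θ.εbg j (histPrefix g j) K) θ.ρ8 θ.bV μ ν z -
            polWindow F K (j + 1)
              (mergedTermFamilyMatT F N (TβOfRecord₁₃ F N) (chiβOfRecord₁₃ F N θ.toStage13Params) θ.εbg j (histPrefix g' j) K) θ.ρ8 θ.bV μ ν z| ≤
          Real.exp (-((ℓ F θ).κ * l1 z)) * ∑ i ∈ Finset.range (j + 1), (ℓ F θ).moduli (j + 1) i * |g i - g' i|)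
    (h5 : ∀ (F : T4Family) (θ : Stage13HParams F N), θ.Provisos₁₃CoPH F N → Rg F θ → θ.Admissible F N → ∀ k : ℕ, ∃ b₀ : ℝ, 0 < b₀ ∧ b₀ ≤ θ.γ ∧
      NE5 ((objectsOfRecord₁₃ F N θ.toStage13Params (ℓ F θ)).EA k) ((objectsOfRecord₁₃ F N θ.toStage13Params (ℓ F θ)).EB k b₀) (Window θ.γ) (ℓ F θ).κ (ℓ F θ).θ₅
        ((ℓ F θ).C₅ - (ℓ F θ).C₉ * θ.γ)) :
    ∀ (F : T4Family) (θ : Stage13HParams F N), θ.Provisos₁₃CoPH F N → Rg F θ → θ.Admissible F N → ∀ k : ℕ,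
      N18At (u3OfRecord₁₃ θ.toStage13Params (objectsOfRecord₁₃ F N θ.toStage13Params (ℓ F θ)) k) := by
  intro F θ hP hRg hθ k
  obtain ⟨b₀, hb₀, hb₀γ, h5'⟩ := h5 F θ hP hRg hθ k
  exact n18At_u3OfRecord₁₃_objectsOfRecord₁₃_of_n22At_of_member F N θ.toStage13Params (ℓ F θ) (hs F θ hP hRg hθ) (hωθ F θ hP hRg hθ) k k
    (n22At_kernels_of_windowed_guarded Rg ℓ hs hlim hK F θ hP hRg hθ k) hb₀ hb₀γ h5'

/-! ## §2 N27 = B5 at the regime record class from a kernel-pinned reading, every U3 slot in producer currency -/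

/-- ★★ **N27 = B5 AT node00-def-RR-2's REGIME RECORD CLASS FROM A KERNEL-PINNED STAGE-13 RATE READING, EVERY U3-KEYED SLOT IN ITS PRODUCER's KERNEL CURRENCY** ((K) §2
`spine_rec13CCoPHOn_holder_of_kernels_pin` with `h22 ↦` §1's windowed face, `h18 ↦` §1's windowed-member face): per guarded tuple the letter inequalities `(ℓ F θ).Signs`, `0 < κ`,
`betaPrime510 4 1 κ ≤ cr`, `ω ≤ θ₅`; `PolLimitExists` of the merged term family of record on the window; the windowed NE9 bounds of record; one NE5 member per run length; the ONE
(5.10) clause `KernelDecayOfRecord₁₃ F N θ.toStage13Params 0 1 (ℓ F θ).κ`; N14 ∕ N15 ∕ N16-at-β stubs at the regime home of `𝔯`; K5's `h20 h21`, `hx`, the N19′ edge `h19` at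
exponent β.  Every displayed antecedent a HYPOTHESIS (0∕1 at the ₁₃ record today); nothing PROVED of Bałaban's; N27 NOT discharged. [bookkeeping] -/
theorem spine_rec13CCoPHOn_holder_of_kernels_pin_of_windowed_member
    (hpin : ∀ (F : T4Family) (θ : Stage13HParams F N) (hP : θ.Provisos₁₃CoPH F N) (g₀ : ℕ → ℝ) (os : List (ULoop F)),
      (𝔯.lit F θ hP g₀ os).u3 = objectsOfRecord₁₃ F N θ.toStage13Params (ℓ F θ))
    (h14 : S_N14 (RRec₁₃CoPHOn 𝔯 Rg)) (h15 : S_N15 (RRec₁₃CoPHOn 𝔯 Rg)) (h16 : S_N16Holder β (RRec₁₃CoPHOn 𝔯 Rg))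
    (hs : ∀ (F : T4Family) (θ : Stage13HParams F N), θ.Provisos₁₃CoPH F N → Rg F θ → θ.Admissible F N → (ℓ F θ).Signs)
    (hκ : ∀ (F : T4Family) (θ : Stage13HParams F N), θ.Provisos₁₃CoPH F N → Rg F θ → θ.Admissible F N → 0 < (ℓ F θ).κ)
    (hcr : ∀ (F : T4Family) (θ : Stage13HParams F N), θ.Provisos₁₃CoPH F N → Rg F θ → θ.Admissible F N → betaPrime510 4 1 (ℓ F θ).κ ≤ (ℓ F θ).cr)
    (hωθ : ∀ (F : T4Family) (θ : Stage13HParams F N), θ.Provisos₁₃CoPH F N → Rg F θ → θ.Admissible F N → (ℓ F θ).ω ≤ (ℓ F θ).θ₅)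
    (hlim : ∀ (F : T4Family) (θ : Stage13HParams F N), θ.Provisos₁₃CoPH F N → Rg F θ → θ.Admissible F N →
      letI := θ.instVβ₁; letI := θ.instVβ₂; letI := θ.instιβ
      ∀ g ∈ Window θ.γ, ∀ j : ℕ,
        PolLimitExists F (j + 1)
          (fun K => mergedTermFamilyMatT F N (TβOfRecord₁₃ F N) (chiβOfRecord₁₃ F N θ.toStage13Params) θ.εbg j (histPrefix g j) K) θ.ρ8 θ.bV)
    (hK : ∀ (F : T4Family) (θ : Stage13HParams F N), θ.Provisos₁₃CoPH F N → Rg F θ → θ.Admissible F N →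
      letI := θ.instVβ₁; letI := θ.instVβ₂; letI := θ.instιβ
      ∀ g ∈ Window θ.γ, ∀ g' ∈ Window θ.γ, ∀ (j : ℕ) (μ ν : Fin 4) (z : Fin 4 → ℤ), ∀ᶠ K in atTop,
        |polWindow F K (j + 1)
              (mergedTermFamilyMatT F N (TβOfRecord₁₃ F N) (chiβOfRecord₁₃ F N θ.toStage13Params) θ.εbg j (histPrefix g j) K) θ.ρ8 θ.bV μ ν z -
            polWindow F K (j + 1)
              (mergedTermFamilyMatT F N (TβOfRecord₁₃ F N) (chiβOfRecord₁₃ F N θ.toStage13Params) θ.εbg j (histPrefix g' j) K) θ.ρ8 θ.bV μ ν z| ≤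
          Real.exp (-((ℓ F θ).κ * l1 z)) * ∑ i ∈ Finset.range (j + 1), (ℓ F θ).moduli (j + 1) i * |g i - g' i|)
    (h5 : ∀ (F : T4Family) (θ : Stage13HParams F N), θ.Provisos₁₃CoPH F N → Rg F θ → θ.Admissible F N → ∀ k : ℕ, ∃ b₀ : ℝ, 0 < b₀ ∧ b₀ ≤ θ.γ ∧
      NE5 ((objectsOfRecord₁₃ F N θ.toStage13Params (ℓ F θ)).EA k) ((objectsOfRecord₁₃ F N θ.toStage13Params (ℓ F θ)).EB k b₀) (Window θ.γ) (ℓ F θ).κ (ℓ F θ).θ₅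
        ((ℓ F θ).C₅ - (ℓ F θ).C₉ * θ.γ))
    (hdec : ∀ (F : T4Family) (θ : Stage13HParams F N), θ.Provisos₁₃CoPH F N → Rg F θ → θ.Admissible F N → KernelDecayOfRecord₁₃ F N θ.toStage13Params 0 1 (ℓ F θ).κ)
    (h20 : S_N20 (SRec₁₃CoPHOn cr Rg)) (h21 : S_N21 (SRec₁₃CoPHOn cr Rg))
    (hx : ∀ (F : T4Family) (θ : Stage13HParams F N) (hP : θ.Provisos₁₃CoPH F N), Rg F θ → θ.Admissible F N →
      B16.EndStatementBPrinted (datumOfRecord₁₃CoPH F N θ hP).C → DagBinding.EndpointExistence (datumOfRecord₁₃CoPH F N θ hP).C.toB12 →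
        ForSmallCouplings (datumOfRecord₁₃CoPH F N θ hP) fun g₀ => ∀ os : List (ULoop F),
          0 < (cr F θ hP g₀ os).l₀ ∧ 0 < (cr F θ hP g₀ os).vol ∧
          (∀ (K : ℕ) (t : ℝ), |t| ≤ (cr F θ hP g₀ os).l₀ →
            T4GenFunBounds.schemeZ ((datumOfRecord₁₃CoPH F N θ hP).scheme g₀) os ((cr F θ hP g₀ os).K₀ + K) t =
              ∑ τ ∈ (cr F θ hP g₀ os).T K, (cr F θ hP g₀ os).A K t τ) ∧
          (∀ (K : ℕ) (t : ℝ), |t| ≤ (cr F θ hP g₀ os).l₀ →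
            T4GenFunBounds.schemeZ ((datumOfRecord₁₃CoPH F N θ hP).scheme g₀) os ((cr F θ hP g₀ os).K₀ + K + 1) t =
              ∑ τ ∈ (cr F θ hP g₀ os).T K, (cr F θ hP g₀ os).B K t τ))
    (h19 : ∀ (F : T4Family) (θ : Stage13HParams F N) (hP : θ.Provisos₁₃CoPH F N), Rg F θ → θ.Admissible F N → ∀ (g₀ : ℕ → ℝ) (os : List (ULoop F)),
      (∀ k : ℕ, RatesHolderAt (datumOfRecord₁₃CoPH F N θ hP) (rateCarriersOfRecord₁₃CoPH 𝔯 F θ hP g₀ os k) β) → letI := (cr F θ hP g₀ os).dec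
        ∃ δ : ℕ → ℝ, NE7.Core (cr F θ hP g₀ os).l₀ (cr F θ hP g₀ os).vol (cr F θ hP g₀ os).T (cr F θ hP g₀ os).Bad
          (fun K t τ => (cr F θ hP g₀ os).A K t τ - (cr F θ hP g₀ os).shA K t τ) (fun K t τ => (cr F θ hP g₀ os).B K t τ - (cr F θ hP g₀ os).shB K t τ) δ ∧
          Summable δ) :
    Spine (N := N) fun F D w => Node00.IsRecordOfRecord₁₃CCoPHOn F N Rg D w :=
  spine_rec13CCoPHOn_holder_of_kernels_pin cr β 𝔯 Rg ℓ hpin h14 h15 h16 (n18At_kernels_of_windowed_member_guarded Rg ℓ hs hωθ hlim hK h5)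
    (n22At_kernels_of_windowed_guarded Rg ℓ hs hlim hK) hs hκ hcr hdec h20 h21 hx h19

end Summit.QuantumFields.YangMills.Theorems.BalabanUVNodesN27SpineRecord
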